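import Literature.MathematicalPhysics.QuantumFieldTheory.Balaban1983to89.T4AdjointCovarianceUnitary

/-!
# `T4Continuum.ShellMeasureVandermondeSUN` — power traces of unitarily diagonalised matrices and the two GRAM
# DETERMINANTS of the exponential Haar Jacobian of `SU(N)`: the discriminant `det[tr H^{a+b}] = ∏_{i<j}(θ_j−θ_i)²` and
# the unitary discriminant `det[tr g^a (g*)^b] = ∏_{i<j}|λ_j−λ_i|²` (Vandermonde)
# (cell `pub-balaban`, sub-cell `t4`, spine estimate NE7c (node U5b); ROUND-2 crew `t4-ne7c-formalise-*`, row S3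
# «SM-L9 SU(N) chart» of `t4/b2b-balaban-t4-ne7c-p1/LEAVES-NE7c-P1.md` (trigger `t4/T4-NE7c-TRIGGER.json`, c5:
# optional and last); seat `b2b-balaban-t4-ne7c-formalise-leaf-04`; file 3 of the row, consumed by
# `ShellMeasureExpJacobianSUN` (the root-space Jacobian `∏_{i<j} sinc²((θ_i−θ_j)/2)` as a MEASURABLE function of the
# chart point); tree target `Summits/QuantumFields/BalabanUV/T4Continuum/Support/`; ADDITIVE — imports the tree's
# `T4AdjointCovarianceUnitary` (for `exp_conj_unitary` and the matrix scopes) and modifies nothing)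

HONEST FRAMING.  Finite four-torus programme, rung (B)+1 only — NOT infinite volume, NOT a mass gap, NOT the Clay
problem, NOT summit progress.  Nothing of [Balaban 1983–89] is mentioned or asserted; NE7c NOT proved and not touched
(spine PROVED 0/9).  PURE LINEAR ALGEBRA over `ℂ`, [folklore], 0 sorry, 0 citations, no `def … : Prop`.

WHY.  The Haar measure of `SU(N)` in exponential coordinates has density `c_N ∏_{α>0} sinc²(α(X)/2)` — for
`X ∈ 𝔰𝔲(N)` with `−iX` of eigenvalues `θ_1,…,θ_N`: `c_N ∏_{i<j} sinc²((θ_i−θ_j)/2)`.  To use it as the one-bond chart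
weight `J₁` of `ShellMeasureScalingSUN.slotAntiConcentration_realized_suN_of_coreMap` it must be a MEASURABLE
function of the chart point, and Mathlib has no measurable (let alone continuous) eigenvalue map.  The companion
file therefore DEFINES the Jacobian by a determinant formula in the matrix entries — the quotient of the two Gram
determinants of this file — which is manifestly measurable, and proves it EQUALS the root-space product off the
null cone of non-regular generators.  This file supplies the two determinant identities.

THE POINTS.
* §1 POWER TRACES.  For a unitary `U` and a diagonal `diagonal d`: `(U·diag d·U*)^m = U·diag(d^m)·U*`
  (`conjDiag_pow`), `tr(U·diag d·U*) = Σ d` (`trace_conjDiag`), products and adjoints of such matrices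
  (`conjDiag_mul_conjDiag`, `star_conjDiag`), hence `tr((U diag d U*)^m) = Σ_k d_k^m` (`trace_conjDiag_pow`).
* §2 THE DISCRIMINANT.  `powTraceMat A = [tr A^{a+b}]_{a,b<N}`, `disc A = det (powTraceMat A)`; for
  `A = U·diag d·U*`: `powTraceMat A = Vᵀ V` with `V = vandermonde d` (`powTraceMat_conjDiag`), so
  `disc A = (det V)² = (∏_{i<j} (d_j − d_i))²` (`disc_conjDiag`, Mathlib's `Matrix.det_vandermonde`).
* §3 THE UNITARY DISCRIMINANT.  `mixTraceMat g = [tr (g^a (g*)^b)]_{a,b<N}`, `udisc g = det (mixTraceMat g)`; for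
  `g = U·diag λ·U*`: `mixTraceMat g = Vᵀ V̄`, `V = vandermonde λ` (`mixTraceMat_conjDiag`), so
  `udisc g = det V · conj (det V) = |∏_{i<j} (λ_j − λ_i)|²` (`udisc_conjDiag`, `udisc_conjDiag_re`).
* §4 CONTINUITY of `A ↦ disc A` and `g ↦ udisc g` (polynomial maps; `continuous_disc`, `continuous_udisc`).
-/

noncomputable section

namespace Summit.QuantumFields.BalabanUV.T4Continuum.ShellMeasureVandermondeSUN

open Matrix Finset
open scoped ComplexConjugate

variable {N : ℕ}

/-! ## §1 Power traces of a unitarily diagonalised matrix -/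

section PowerTrace

/-- the unitarily diagonalised matrix `U · diagonal d · U*`. [folklore] -/
def conjDiag (U : Matrix.unitaryGroup (Fin N) ℂ) (d : Fin N → ℂ) : Matrix (Fin N) (Fin N) ℂ :=
  (U : Matrix (Fin N) (Fin N) ℂ) * diagonal d * star (U : Matrix (Fin N) (Fin N) ℂ)

variable (U : Matrix.unitaryGroup (Fin N) ℂ)

/-- `U* U = 1`. [folklore] -/
theorem star_coe_mul_coe : star (U : Matrix (Fin N) (Fin N) ℂ) * (U : Matrix (Fin N) (Fin N) ℂ) = 1 :=
  Unitary.coe_star_mul_self U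

/-- `U U* = 1`. [folklore] -/
theorem coe_mul_star_coe : (U : Matrix (Fin N) (Fin N) ℂ) * star (U : Matrix (Fin N) (Fin N) ℂ) = 1 :=
  Unitary.coe_mul_star_self U

/-- products of unitarily diagonalised matrices multiply their diagonals. [folklore] -/
theorem conjDiag_mul_conjDiag (d e : Fin N → ℂ) : conjDiag U d * conjDiag U e = conjDiag U (d * e) := by
  unfold conjDiag
  calc (U : Matrix (Fin N) (Fin N) ℂ) * diagonal d * star (U : Matrix (Fin N) (Fin N) ℂ) *
        ((U : Matrix (Fin N) (Fin N) ℂ) * diagonal e * star (U : Matrix (Fin N) (Fin N) ℂ))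
      = (U : Matrix (Fin N) (Fin N) ℂ) * diagonal d *
          (star (U : Matrix (Fin N) (Fin N) ℂ) * (U : Matrix (Fin N) (Fin N) ℂ)) * diagonal e *
          star (U : Matrix (Fin N) (Fin N) ℂ) := by simp only [Matrix.mul_assoc]
    _ = (U : Matrix (Fin N) (Fin N) ℂ) * diagonal (d * e) * star (U : Matrix (Fin N) (Fin N) ℂ) := by
        rw [star_coe_mul_coe, Matrix.mul_one, Matrix.mul_assoc _ (diagonal d), diagonal_mul_diagonal]
        rfl

/-- `conjDiag U 1 = 1`. [folklore] -/
theorem conjDiag_one : conjDiag U (1 : Fin N → ℂ) = 1 := by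
  unfold conjDiag
  rw [show (1 : Fin N → ℂ) = fun _ => 1 from rfl, diagonal_one, Matrix.mul_one, coe_mul_star_coe]

/-- powers of a unitarily diagonalised matrix: `(U·diag d·U*)^m = U·diag(d^m)·U*`. [folklore] -/
theorem conjDiag_pow (d : Fin N → ℂ) (m : ℕ) : conjDiag U d ^ m = conjDiag U (d ^ m) := by
  induction m with
  | zero => rw [pow_zero, pow_zero, conjDiag_one]
  | succ m ih => rw [pow_succ, ih, conjDiag_mul_conjDiag, ← pow_succ]

/-- the adjoint of a unitarily diagonalised matrix: `(U·diag d·U*)* = U·diag(d̄)·U*`. [folklore] -/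
theorem star_conjDiag (d : Fin N → ℂ) : star (conjDiag U d) = conjDiag U (star d) := by
  unfold conjDiag
  rw [star_mul, star_mul, star_star, star_eq_conjTranspose (diagonal d), diagonal_conjTranspose, Matrix.mul_assoc]

/-- scalar multiples: `c • (U·diag d·U*) = U·diag(c•d)·U*`. [folklore] -/
theorem smul_conjDiag (c : ℂ) (d : Fin N → ℂ) : c • conjDiag U d = conjDiag U (c • d) := by
  unfold conjDiag
  rw [diagonal_smul, Matrix.mul_smul, Matrix.smul_mul]

/-- the trace of a unitarily diagonalised matrix is the sum of its diagonal. [folklore] -/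
theorem trace_conjDiag (d : Fin N → ℂ) : trace (conjDiag U d) = ∑ i, d i := by
  unfold conjDiag
  rw [trace_mul_cycle, star_coe_mul_coe, Matrix.one_mul, trace_diagonal]

/-- **POWER TRACES**: `tr((U·diag d·U*)^m) = Σ_k d_k^m`. [folklore] -/
theorem trace_conjDiag_pow (d : Fin N → ℂ) (m : ℕ) : trace (conjDiag U d ^ m) = ∑ i, d i ^ m := by
  rw [conjDiag_pow, trace_conjDiag]
  rfl

/-- mixed products: `(U·diag d·U*)^a · ((U·diag d·U*)*)^b = U·diag(d^a · d̄^b)·U*`. [folklore] -/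
theorem conjDiag_pow_mul_star_pow (d : Fin N → ℂ) (a b : ℕ) :
    conjDiag U d ^ a * star (conjDiag U d) ^ b = conjDiag U (d ^ a * star d ^ b) := by
  rw [star_conjDiag, conjDiag_pow, conjDiag_pow, conjDiag_mul_conjDiag]

end PowerTrace

/-! ## §2 The discriminant `det[tr A^{a+b}] = ∏_{i<j} (d_j − d_i)²` -/

section Disc

/-- the POWER-TRACE GRAM MATRIX `[tr A^{a+b}]_{a,b<N}`. [folklore] -/
def powTraceMat (A : Matrix (Fin N) (Fin N) ℂ) : Matrix (Fin N) (Fin N) ℂ :=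
  of fun a b => trace (A ^ ((a : ℕ) + b))

/-- the DISCRIMINANT of `A` as a polynomial in its entries: `det [tr A^{a+b}]`. [folklore] -/
def disc (A : Matrix (Fin N) (Fin N) ℂ) : ℂ := det (powTraceMat A)

variable (U : Matrix.unitaryGroup (Fin N) ℂ)

/-- for a unitarily diagonalised matrix the power-trace Gram matrix is `Vᵀ V`, `V` the Vandermonde matrix of the
diagonal. [folklore] -/
theorem powTraceMat_conjDiag (d : Fin N → ℂ) :
    powTraceMat (conjDiag U d) = (vandermonde d)ᵀ * vandermonde d := by
  ext a b
  rw [powTraceMat, of_apply, trace_conjDiag_pow, mul_apply]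
  refine sum_congr rfl fun k _ => ?_
  rw [transpose_apply, vandermonde_apply, vandermonde_apply, pow_add]

/-- **THE DISCRIMINANT OF A UNITARILY DIAGONALISED MATRIX**: `disc (U·diag d·U*) = (∏_{i<j} (d_j − d_i))²`.
[folklore] -/
theorem disc_conjDiag (d : Fin N → ℂ) :
    disc (conjDiag U d) = (∏ i : Fin N, ∏ j ∈ Ioi i, (d j - d i)) ^ 2 := by
  rw [disc, powTraceMat_conjDiag, det_mul, det_transpose, det_vandermonde, sq]

/-- … with a REAL diagonal `θ`: `disc = ((∏_{i<j} (θ_j − θ_i))² : ℝ)`. [folklore] -/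
theorem disc_conjDiag_ofReal (θ : Fin N → ℝ) :
    disc (conjDiag U (fun k => (θ k : ℂ))) = (((∏ i : Fin N, ∏ j ∈ Ioi i, (θ j - θ i)) ^ 2 : ℝ) : ℂ) := by
  rw [disc_conjDiag]
  push_cast
  rfl

/-- … so its real part is `(∏_{i<j} (θ_j − θ_i))²`. [folklore] -/
theorem disc_conjDiag_re (θ : Fin N → ℝ) :
    (disc (conjDiag U (fun k => (θ k : ℂ)))).re = (∏ i : Fin N, ∏ j ∈ Ioi i, (θ j - θ i)) ^ 2 := by
  rw [disc_conjDiag_ofReal, Complex.ofReal_re]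

end Disc

/-! ## §3 The unitary discriminant `det[tr g^a (g*)^b] = ∏_{i<j} |λ_j − λ_i|²` -/

section UDisc

/-- the MIXED-TRACE GRAM MATRIX `[tr (g^a (g*)^b)]_{a,b<N}`. [folklore] -/
def mixTraceMat (g : Matrix (Fin N) (Fin N) ℂ) : Matrix (Fin N) (Fin N) ℂ :=
  of fun a b => trace (g ^ (a : ℕ) * star g ^ (b : ℕ))

/-- the UNITARY DISCRIMINANT of `g` as a polynomial in its entries and their conjugates: `det [tr (g^a (g*)^b)]`.
[folklore] -/
def udisc (g : Matrix (Fin N) (Fin N) ℂ) : ℂ := det (mixTraceMat g)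

variable (U : Matrix.unitaryGroup (Fin N) ℂ)

/-- for a unitarily diagonalised matrix the mixed-trace Gram matrix is `Vᵀ V̄`, `V` the Vandermonde matrix of the
diagonal. [folklore] -/
theorem mixTraceMat_conjDiag (d : Fin N → ℂ) :
    mixTraceMat (conjDiag U d) = (vandermonde d)ᵀ * (vandermonde d).map conj := by
  ext a b
  rw [mixTraceMat, of_apply, conjDiag_pow_mul_star_pow, trace_conjDiag, mul_apply]
  refine sum_congr rfl fun k _ => ?_
  rw [transpose_apply, map_apply, vandermonde_apply, vandermonde_apply, Pi.mul_apply, Pi.pow_apply, Pi.pow_apply,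
    Pi.star_apply, Complex.star_def, map_pow]

/-- **THE UNITARY DISCRIMINANT OF A UNITARILY DIAGONALISED MATRIX**: `udisc (U·diag λ·U*) = det V · conj (det V)`,
`det V = ∏_{i<j} (λ_j − λ_i)`. [folklore] -/
theorem udisc_conjDiag (d : Fin N → ℂ) :
    udisc (conjDiag U d) =
      (∏ i : Fin N, ∏ j ∈ Ioi i, (d j - d i)) * conj (∏ i : Fin N, ∏ j ∈ Ioi i, (d j - d i)) := by
  rw [udisc, mixTraceMat_conjDiag, det_mul, det_transpose, ← RingHom.mapMatrix_apply, ← RingHom.map_det,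
    det_vandermonde]

/-- … as a real number: `udisc (U·diag λ·U*) = |∏_{i<j} (λ_j − λ_i)|² = ∏_{i<j} |λ_j − λ_i|²`. [folklore] -/
theorem udisc_conjDiag_eq_normSq (d : Fin N → ℂ) :
    udisc (conjDiag U d) = ((∏ i : Fin N, ∏ j ∈ Ioi i, Complex.normSq (d j - d i) : ℝ) : ℂ) := by
  rw [udisc_conjDiag, Complex.mul_conj]
  congr 1
  rw [map_prod]
  exact prod_congr rfl fun i _ => map_prod _ _ _

/-- … so its real part is `∏_{i<j} |λ_j − λ_i|²`. [folklore] -/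
theorem udisc_conjDiag_re (d : Fin N → ℂ) :
    (udisc (conjDiag U d)).re = ∏ i : Fin N, ∏ j ∈ Ioi i, Complex.normSq (d j - d i) := by
  rw [udisc_conjDiag_eq_normSq, Complex.ofReal_re]

end UDisc

/-! ## §4 Continuity of the two discriminants (polynomial maps of the entries) -/

section Continuity

/-- `A ↦ disc A` is continuous. [folklore] -/
theorem continuous_disc : Continuous (disc (N := N)) := by
  unfold disc powTraceMat
  refine Continuous.matrix_det (continuous_matrix fun a b => ?_)
  exact ((continuous_id.pow _).matrix_trace)

/-- `g ↦ udisc g` is continuous. [folklore] -/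
theorem continuous_udisc : Continuous (udisc (N := N)) := by
  unfold udisc mixTraceMat
  refine Continuous.matrix_det (continuous_matrix fun a b => ?_)
  exact ((continuous_id.pow _).mul ((continuous_id.star).pow _)).matrix_trace

end Continuity

end Summit.QuantumFields.BalabanUV.T4Continuum.ShellMeasureVandermondeSUN

end
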